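import Summits.PneNP.PneNP.Theorems.SymmetryBudgetWindowCanoniserReplayDefs

/-!
# Window canoniser, XIII: gate semantics of the replay — flags, switched graph, reachability

Route `PneNP/SymmetryBudget`, dichotomy `WindowBarrier` (stmt-PneNP-2145) / `NoHiddenOrder` (stmt-PneNP-14781);
continuation of `…WindowCanoniserReplayDefs.lean`.  Assuming the state gates of iteration `it` of label `L`
hold the state `S` (`WCan.Corr L x it S`), the derived gates of that iteration compute: `now`/`frz`/`cnt1`
(`nowP`, `frzP`, `|W| ≤ 1`); the switch bit `sw v w` (`WCan.swP`: `|cell v|·|cell w| < 2·#edges`, which inside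
`W` is `Switch (within G W) (liftCol W c)` of the tree); `reach s` (`WCan.reachK`: path doubling from the
switched graph `CGCanon.swG`), hence `reach n u y ↔ u ∈ W ∧ swG-reachable` and `conn ↔ CGCanon.IsConn`.
-/

-- `Summit.PneNP.PneNP.…` duplicates `PneNP` BY DESIGN (single-problem summit, D-0017 layout).
set_option linter.dupNamespace false

noncomputable section

namespace Summit.PneNP.PneNP.Theorems

namespace WCan

open Finset Literature.Computability.Complexity Literature.Computability.Complexity.CGCanon
  Literature.Combinatorics.SimpleGraph
open scoped Classical

variable {K r n : ℕ}

/-! ### State-level notions (no gates) -/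

section StateLevel

variable (x : Fin (r + n) × Fin (r + n) → Bool)

/-- Components of an encoded pair. -/
@[simp] theorem divNat_pair (q : Fin n × Fin n) : (finProdFinEquiv q).divNat = q.1 := by
  have := congrArg Prod.fst (finProdFinEquiv.symm_apply_apply q)
  rwa [finProdFinEquiv_symm_apply] at this

/-- Components of an encoded pair. -/
@[simp] theorem modNat_pair (q : Fin n × Fin n) : (finProdFinEquiv q).modNat = q.2 := by
  have := congrArg Prod.snd (finProdFinEquiv.symm_apply_apply q)
  rwa [finProdFinEquiv_symm_apply] at this

/-- Counting encoded pairs is counting pairs. -/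
theorem card_filter_divmod (P : Fin n → Fin n → Prop) [DecidablePred fun i : Fin (n * n) => P i.divNat i.modNat]
    [DecidablePred fun ab : Fin n × Fin n => P ab.1 ab.2] :
    (univ.filter fun i : Fin (n * n) => P i.divNat i.modNat).card = ((univ : Finset (Fin n × Fin n)).filter fun ab => P ab.1 ab.2).card := by
  refine card_bij (fun i _ => (i.divNat, i.modNat)) (fun i hi => by simpa using hi) (fun i _ j _ hij => ?_) (fun ab hab => ?_)
  · apply finProdFinEquiv.symm.injective
    simpa [Prod.ext_iff] using hij
  · refine ⟨finProdFinEquiv ab, ?_, ?_⟩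
    · simp only [mem_filter, mem_univ, true_and, divNat_pair, modNat_pair] at hab ⊢; exact hab
    · simp

/-- The lifted cell of `v`: vertices of `W` with the lifted colour of `v` (the cell of `v` if `v ∈ W`, else `∅`). -/
def lcell (S : St n) (v : Fin n) : Finset (Fin n) := S.W.filter fun y => liftCol S.W S.c y = liftCol S.W S.c v

/-- Inside `W` the lifted cell is the cell. -/
theorem lcell_eq_cell {S : St n} {v : Fin n} (hv : v ∈ S.W) : lcell S v = cell S.W S.c v := by
  ext y; simp only [lcell, mem_filter, mem_cell]
  constructor
  · rintro ⟨hy, he⟩; exact ⟨hy, (liftCol_eq_liftCol_iff hy hv).1 he⟩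
  · rintro ⟨hy, he⟩; exact ⟨hy, (liftCol_eq_liftCol_iff hy hv).2 he⟩

/-- Outside `W` the lifted cell is empty. -/
theorem lcell_eq_empty {S : St n} {v : Fin n} (hv : v ∉ S.W) : lcell S v = ∅ := by
  refine filter_eq_empty_iff.2 fun y hy he => ?_
  rw [liftCol_of_mem _ hy, liftCol_of_not_mem _ hv] at he
  exact Nat.succ_ne_zero _ he

/-- Membership in the lifted cell through the lifted order. -/
theorem mem_lcell_iff {S : St n} {a y : Fin n} : a ∈ lcell S y ↔ a ∈ S.W ∧ ¬ S.liftLT y a ∧ ¬ S.liftLT a y := by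
  rw [lcell, mem_filter, St.liftLT_iff, St.liftLT_iff]
  constructor
  · rintro ⟨h1, h2⟩; exact ⟨h1, by omega, by omega⟩
  · rintro ⟨h1, h2, h3⟩; exact ⟨h1, by omega⟩

/-- The SWITCH PREDICATE of two vertices: their lifted cells induce a dense block. -/
def swP (S : St n) (v w : Fin n) : Prop :=
  (lcell S v).card * (lcell S w).card <
    2 * ((univ : Finset (Fin n × Fin n)).filter fun ab => ab.1 ∈ lcell S v ∧ ab.2 ∈ lcell S w ∧ (G x).Adj ab.1 ab.2).card

/-- **Inside `W`, `swP` is the switch bit of the tree's switched graph.** -/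
theorem swP_iff_switch {S : St n} {v w : Fin n} (hv : v ∈ S.W) (hw : w ∈ S.W) :
    swP x S v w ↔ Switch (within (G x) S.W) (liftCol S.W S.c) (liftCol S.W S.c v) (liftCol S.W S.c w) := by
  unfold swP Switch
  rw [cellCard_liftCol _ hv, cellCard_liftCol _ hw, lcell_eq_cell hv, lcell_eq_cell hw]
  have : crossEdges (within (G x) S.W) (liftCol S.W S.c) (liftCol S.W S.c v) (liftCol S.W S.c w) =
      ((univ : Finset (Fin n × Fin n)).filter fun ab => ab.1 ∈ cell S.W S.c v ∧ ab.2 ∈ cell S.W S.c w ∧ (G x).Adj ab.1 ab.2).card := by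
    unfold crossEdges
    congr 1
    ext ⟨a, b⟩
    simp only [mem_filter, mem_univ, true_and, within_adj, mem_cell]
    constructor
    · rintro ⟨ha, hb, haW, hbW, hadj⟩
      exact ⟨⟨haW, (liftCol_eq_liftCol_iff haW hv).1 ha⟩, ⟨hbW, (liftCol_eq_liftCol_iff hbW hw).1 hb⟩, hadj⟩
    · rintro ⟨⟨haW, ha⟩, ⟨hbW, hb⟩, hadj⟩
      exact ⟨(liftCol_eq_liftCol_iff haW hv).2 ha, (liftCol_eq_liftCol_iff hbW hw).2 hb, haW, hbW, hadj⟩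
  rw [this]

/-- PATH DOUBLING from the switched graph: `reachK S 0 u y` iff `u = y ∈ W` or `u ~ y` in `swG`;
`reachK S (s+1) u y` iff through some midpoint. -/
def reachK (S : St n) : ℕ → Fin n → Fin n → Prop
  | 0, u, y => (u = y ∧ u ∈ S.W) ∨ (swG (G x) S.W S.c).Adj u y
  | s + 1, u, y => ∃ z, reachK S s u z ∧ reachK S s z y

/-- `reachK` stays inside `W` and inside the reachability relation of the switched graph. -/
theorem reachK_sound {S : St n} : ∀ (s : ℕ) {u y : Fin n}, reachK x S s u y → u ∈ S.W ∧ y ∈ S.W ∧ (swG (G x) S.W S.c).Reachable u y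
  | 0, u, y, h => by
    rcases h with ⟨rfl, hu⟩ | hadj
    · exact ⟨hu, hu, SimpleGraph.Reachable.refl _⟩
    · obtain ⟨hu, hy⟩ := swG_mem hadj
      exact ⟨hu, hy, hadj.reachable⟩
  | s + 1, u, y, ⟨z, h1, h2⟩ => by
    obtain ⟨hu, -, r1⟩ := reachK_sound s h1
    obtain ⟨-, hy, r2⟩ := reachK_sound s h2
    exact ⟨hu, hy, r1.trans r2⟩

/-- `reachK` is reflexive on `W` at every level. -/
theorem reachK_refl {S : St n} : ∀ (s : ℕ) {u : Fin n}, u ∈ S.W → reachK x S s u u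
  | 0, _, hu => Or.inl ⟨rfl, hu⟩
  | s + 1, _, hu => ⟨_, reachK_refl s hu, reachK_refl s hu⟩

/-- `reachK` is monotone in the level. -/
theorem reachK_mono {S : St n} (s : ℕ) {u y : Fin n} (h : reachK x S s u y) : reachK x S (s + 1) u y :=
  ⟨_, h, reachK_refl x s (reachK_sound x s h).2.1⟩

/-- An edge of the switched graph is captured at every level. -/
theorem reachK_of_adj {S : St n} : ∀ (s : ℕ) {u z : Fin n}, (swG (G x) S.W S.c).Adj u z → reachK x S s u z
  | 0, _, _, hadj => Or.inr hadj
  | s + 1, _, _, hadj => reachK_mono x s (reachK_of_adj s hadj)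

/-- A walk of the switched graph of length `≤ s` from a vertex of `W` is captured by `reachK s`. -/
theorem reachK_of_walk {S : St n} : ∀ {u y : Fin n} (p : (swG (G x) S.W S.c).Walk u y) (s : ℕ), u ∈ S.W → p.length ≤ s →
    reachK x S s u y
  | _, _, SimpleGraph.Walk.nil, s, hu, _ => reachK_refl x s hu
  | _, _, SimpleGraph.Walk.cons hadj p, 0, _, hs => by simp at hs
  | _, _, SimpleGraph.Walk.cons hadj p, s + 1, _, hs =>
    ⟨_, reachK_of_adj x s hadj, reachK_of_walk p s (swG_mem hadj).2 (by simp at hs; omega)⟩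

/-- **`reachK n` is reachability in the switched graph (from inside `W`).** -/
theorem reachK_last_iff {S : St n} {u y : Fin n} : reachK x S n u y ↔ u ∈ S.W ∧ (swG (G x) S.W S.c).Reachable u y := by
  constructor
  · intro h; have := reachK_sound x n h; exact ⟨this.1, this.2.2⟩
  · rintro ⟨hu, hr⟩
    obtain ⟨p, hp⟩ := hr.exists_isPath
    refine reachK_of_walk x p n hu ?_
    have := hp.length_lt
    rw [Fintype.card_fin] at this
    omega

end StateLevel

/-! ### The state gates hold a state -/

variable [NeZero n] (L : Lab K n) (x : Fin (r + n) × Fin (r + n) → Bool)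

/-- **The state gates of iteration `it` of `L` hold the state `S`.** -/
structure Corr (it : Fin (T n + 1)) (S : St n) : Prop where
  /-- `W it v` -/
  W : ∀ v, ev x (aW (r := r) L it v) = decide (v ∈ S.W)
  /-- `LT it u w` -/
  LT : ∀ u w, ev x (aLT (r := r) L it u w) = decide (S.liftLT u w)
  /-- `C it v` -/
  C : ∀ v, ev x (aC (r := r) L it v) = decide (v ∈ S.C)
  /-- `ARR it` -/
  arr : ∀ z, ev x (aARR (r := r) L it z) = S.arr
  /-- `DEAD it` -/
  dead : ∀ z, ev x (aDEAD (r := r) L it z) = S.dead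

variable {L x} {it : Fin (T n + 1)} {S : St n} (h : Corr L x it S)
include h

/-! ### Flags -/

/-- `now it` computes `nowP`. -/
theorem ev_aNow (z : Fin n) : ev x (aNow (r := r) L it z) = decide (nowP L.1 S) := by
  apply Bool.eq_iff_iff.2
  show Vl K x _ = true ↔ _
  rw [Vl_eq, decide_eq_true_iff]
  show (GateFn.and (n + n)).2 (fun i => GateDAG.wire x (Vl K x) (Kind.argsR L .now (prm (vec1 z) (it := it)) i)) = true ↔ _
  simp only [GateFn.and, decide_eq_true_iff, Kind.argsR, prm_it]
  rw [Fin.forall_fin_add]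
  simp only [Fin.append_left, Fin.append_right]
  have hW : ∀ v, GateDAG.wire x (Vl K x) (if v ∈ L.1.U then wA (aW L it v) else wN (aW L it v)) = true ↔ (v ∈ S.W ↔ v ∈ L.1.U) := by
    intro v; split_ifs with hv <;> simp [h.W, hv]
  have hC : ∀ v, GateDAG.wire x (Vl K x) (if v ∈ L.1.X then wA (aC L it v) else wN (aC L it v)) = true ↔ (v ∈ S.C ↔ v ∈ L.1.X) := by
    intro v; split_ifs with hv <;> simp [h.C, hv]
  simp only [hW, hC, nowP, Finset.ext_iff]

/-- `frz it` computes `frzP`. -/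
theorem ev_aFrz (z : Fin n) : ev x (aFrz (r := r) L it z) = decide (frzP L.1 S) := by
  apply Bool.eq_iff_iff.2
  show Vl K x _ = true ↔ _
  rw [Vl_eq, decide_eq_true_iff]
  show (GateFn.or 3).2 (fun i => GateDAG.wire x (Vl K x) (Kind.argsR L .frz (prm (vec1 z) (it := it)) i)) = true ↔ _
  simp only [GateFn.or, decide_eq_true_iff, Kind.argsR, prm_it, prm_vs, vec1_apply, Fin.exists_fin_succ]
  simp [h.arr, h.dead, ev_aNow h, frzP]

/-- `cnt1 it` computes `|W| ≤ 1`. -/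
theorem ev_aCnt1 (z : Fin n) : ev x (aCnt1 (r := r) L it z) = decide (S.W.card ≤ 1) := by
  apply Bool.eq_iff_iff.2
  show Vl K x _ = true ↔ _
  rw [Vl_eq, decide_eq_true_iff]
  show (GateFn.maj (n + n)).2 (fun i => GateDAG.wire x (Vl K x) (cnt n (n - 1) (fun v => wN (aW L it v)) i)) = true ↔ _
  rw [maj_cnt_iff x (Nat.sub_le n 1)]
  simp only [wire_wN, h.W, Bool.not_eq_true', decide_eq_false_iff_not]
  have : (univ.filter fun v : Fin n => v ∉ S.W) = univ \ S.W := by ext v; simp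
  rw [this, card_univ_sdiff, Fintype.card_fin]
  have := card_le_univ S.W
  rw [Fintype.card_fin] at this
  have hn : 1 ≤ n := NeZero.one_le
  omega

/-! ### The switched graph -/

/-- `WEF it v y` holds iff `y` is in the lifted cell of `v`. -/
theorem Vl_WEF (v y : Fin n) : Vl K x (.f1 (WEF (r := r) L it v y)) = true ↔ y ∈ lcell S v := by
  rw [WEF, Vl_n1and x _ (by simp), mem_lcell_iff]
  simp [h.W, h.LT]

/-- `nWEF it v y` holds iff `y` is not in the lifted cell of `v`. -/
theorem Vl_nWEF (v y : Fin n) : Vl K x (.f1 (nWEF (r := r) L it v y)) = true ↔ y ∉ lcell S v := by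
  rw [nWEF, Vl_n1or x _ (by simp), mem_lcell_iff]
  simp only [List.mem_cons, List.not_mem_nil, or_false, exists_eq_or_imp, exists_eq_left, holds_pos, holds_neg, h.W, h.LT,
    decide_eq_true_eq, decide_eq_false_iff_not]
  by_cases hy : y ∈ S.W <;> by_cases h1 : S.liftLT v y <;> by_cases h2 : S.liftLT y v <;> simp [hy, h1, h2]

/-- `sw it v w` computes `swP`. -/
theorem ev_aSw (v w : Fin n) : ev x (aSw (r := r) L it v w) = decide (swP x S v w) := by
  apply Bool.eq_iff_iff.2
  show Vl K x _ = true ↔ _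
  rw [Vl_eq, decide_eq_true_iff]
  let E : Fin (n * n) → Wire K r n := fun i =>
    w1 (n1and [pos (aW L it i.divNat), neg (aLT L it v i.divNat), neg (aLT L it i.divNat v), pos (aW L it i.modNat),
      neg (aLT L it w i.modNat), neg (aLT L it i.modNat w), adjLit i.divNat i.modNat])
  let NP : Fin (n * n) → Wire K r n := fun i =>
    w1 (n1or [neg (aW L it i.divNat), pos (aLT L it v i.divNat), pos (aLT L it i.divNat v), neg (aW L it i.modNat),
      pos (aLT L it w i.modNat), pos (aLT L it i.modNat w)])
  show (GateFn.maj (n * n + n * n + n * n + (n * n + n * n + n * n))).2 (fun i => GateDAG.wire x (Vl K x)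
    (cnt (n * n + n * n + n * n) (n * n + 1) (Fin.append (Fin.append E E) NP) i)) = true ↔ _
  have hnn : n * n + 1 ≤ n * n + n * n + n * n := by have := NeZero.one_le (n := n); nlinarith
  rw [maj_cnt_iff x hnn]
  have hE : ∀ i, GateDAG.wire x (Vl K x) (E i) = true ↔ (i.divNat ∈ lcell S v ∧ i.modNat ∈ lcell S w ∧ (G x).Adj i.divNat i.modNat) := by
    intro i
    rw [mem_lcell_iff, mem_lcell_iff]
    simp only [E, wire_w1]
    rw [Vl_n1and x _ (by simp)]
    simp only [List.mem_cons, List.not_mem_nil, or_false, forall_eq_or_imp, forall_eq, holds_pos, holds_neg, h.W, h.LT,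
      decide_eq_true_eq, decide_eq_false_iff_not, holds_adjLit]
    tauto
  have hNP : ∀ i, GateDAG.wire x (Vl K x) (NP i) = true ↔ ¬ (i.divNat ∈ lcell S v ∧ i.modNat ∈ lcell S w) := by
    intro i
    rw [mem_lcell_iff, mem_lcell_iff]
    simp only [NP, wire_w1]
    rw [Vl_n1or x _ (by simp)]
    simp only [List.mem_cons, List.not_mem_nil, or_false, exists_eq_or_imp, exists_eq_left, holds_pos, holds_neg, h.W, h.LT,
      decide_eq_true_eq, decide_eq_false_iff_not]
    by_cases h1 : i.divNat ∈ S.W <;> by_cases h2 : S.liftLT v i.divNat <;> by_cases h3 : S.liftLT i.divNat v <;>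
      by_cases h4 : i.modNat ∈ S.W <;> by_cases h5 : S.liftLT w i.modNat <;> by_cases h6 : S.liftLT i.modNat w <;>
      simp [h1, h2, h3, h4, h5, h6]
  have hsplit : (univ.filter fun i : Fin (n * n + n * n + n * n) => GateDAG.wire x (Vl K x) (Fin.append (Fin.append E E) NP i) = true).card =
      (univ.filter fun i => GateDAG.wire x (Vl K x) (E i) = true).card + (univ.filter fun i => GateDAG.wire x (Vl K x) (E i) = true).card +
      (univ.filter fun i => GateDAG.wire x (Vl K x) (NP i) = true).card := by
    rw [card_filter, card_filter, card_filter, Fin.sum_univ_add, Fin.sum_univ_add]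
    simp only [Fin.append_left, Fin.append_right]
  rw [hsplit]
  have hEc : (univ.filter fun i => GateDAG.wire x (Vl K x) (E i) = true).card =
      ((univ : Finset (Fin n × Fin n)).filter fun ab => ab.1 ∈ lcell S v ∧ ab.2 ∈ lcell S w ∧ (G x).Adj ab.1 ab.2).card := by
    rw [show (univ.filter fun i => GateDAG.wire x (Vl K x) (E i) = true) =
      univ.filter fun i : Fin (n * n) => i.divNat ∈ lcell S v ∧ i.modNat ∈ lcell S w ∧ (G x).Adj i.divNat i.modNat from by
        ext i; simp only [mem_filter, mem_univ, true_and, hE]]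
    exact card_filter_divmod (fun a b => a ∈ lcell S v ∧ b ∈ lcell S w ∧ (G x).Adj a b)
  have hprod : ((univ : Finset (Fin n × Fin n)).filter fun ab => ab.1 ∈ lcell S v ∧ ab.2 ∈ lcell S w).card = (lcell S v).card * (lcell S w).card := by
    rw [← card_product]; congr 1; ext ab; simp
  have hNPc : (univ.filter fun i => GateDAG.wire x (Vl K x) (NP i) = true).card = n * n - (lcell S v).card * (lcell S w).card := by
    have h1 : (univ.filter fun i => GateDAG.wire x (Vl K x) (NP i) = true) =
        univ \ (univ.filter fun i : Fin (n * n) => i.divNat ∈ lcell S v ∧ i.modNat ∈ lcell S w) := by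
      ext i; simp only [mem_filter, mem_univ, true_and, hNP, mem_sdiff]
    rw [h1, card_univ_sdiff, Fintype.card_fin, ← hprod]
    congr 1
    exact card_filter_divmod (fun a b => a ∈ lcell S v ∧ b ∈ lcell S w)
  rw [hEc, hNPc, swP]
  have hle2 : ((univ : Finset (Fin n × Fin n)).filter fun ab => ab.1 ∈ lcell S v ∧ ab.2 ∈ lcell S w ∧ (G x).Adj ab.1 ab.2).card ≤
      (lcell S v).card * (lcell S w).card := by
    rw [← hprod]; exact card_le_card (fun ab => by simp only [mem_filter, mem_univ, true_and]; tauto)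
  have hle : (lcell S v).card * (lcell S w).card ≤ n * n := by
    rw [← hprod]; exact (card_le_univ _).trans_eq (by simp)
  omega

/-! ### Reachability -/

/-- The base wire of reachability. -/
theorem wire_reach0W (u y : Fin n) : GateDAG.wire x (Vl K x) (reach0W (r := r) L it u y) = true ↔ reachK x S 0 u y := by
  unfold reach0W
  by_cases huy : u = y
  · subst huy
    simp [h.W, reachK]
  · rw [if_neg huy]
    have hadjG : (G x).Adj u y ↔ ev x (aExV (K := K) u y) = true := by rw [ev_aExV, G_adj]; simp [huy]
    simp only [wire_w2]
    rw [Vl_n2or x _ (by simp)]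
    simp only [List.mem_cons, List.not_mem_nil, or_false, exists_eq_or_imp, exists_eq_left]
    rw [Vl_n1and x _ (by simp), Vl_n1and x _ (by simp)]
    simp only [List.mem_cons, List.not_mem_nil, or_false, forall_eq_or_imp, forall_eq, holds_pos, holds_neg, h.W,
      decide_eq_true_eq, ev_aSw h, decide_eq_false_iff_not, reachK, huy, false_and, false_or]
    constructor
    · rintro (⟨hu, hy, hadj, hsw⟩ | ⟨hu, hy, hadj, hsw⟩)
      · rw [swG_adj_iff hu hy, ← swP_iff_switch x hu hy]
        exact ⟨huy, iff_of_true (hadjG.2 hadj) hsw⟩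
      · rw [swG_adj_iff hu hy, ← swP_iff_switch x hu hy]
        refine ⟨huy, iff_of_false (fun h' => ?_) (not_not.2 hsw)⟩
        rw [hadjG, hadj] at h'; exact Bool.false_ne_true h'
    · intro hadj
      obtain ⟨hu, hy⟩ := swG_mem hadj
      rw [swG_adj_iff hu hy, ← swP_iff_switch x hu hy, hadjG] at hadj
      by_cases hsw : swP x S u y
      · refine Or.inr ⟨hu, hy, ?_, hsw⟩
        cases he : ev x (aExV (K := K) u y)
        · rfl
        · exact absurd hsw (hadj.2.1 he)
      · refine Or.inl ⟨hu, hy, hadj.2.2 hsw, hsw⟩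

/-- **`reach it s u y` computes `reachK s`.** -/
theorem ev_aReach (s : Fin (n + 1)) (u y : Fin n) : ev x (aReach (r := r) L it s u y) = decide (reachK x S s u y) := by
  obtain ⟨sv, hs⟩ := s
  induction sv generalizing u y with
  | zero =>
    apply Bool.eq_iff_iff.2
    show Vl K x _ = true ↔ _
    rw [Vl_eq, decide_eq_true_iff]
    show (GateFn.or n).2 (fun i => GateDAG.wire x (Vl K x) (Kind.argsR L .reach (prm (vec2 u y) (it := it) (rd := ⟨0, hs⟩)) i)) = true ↔ _
    simp only [GateFn.or, decide_eq_true_iff, Kind.argsR, prm_it, prm_vs, prm_rd, vec2_0, vec2_1]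
    constructor
    · rintro ⟨_, hi⟩; exact (wire_reach0W h u y).1 hi
    · intro hi; exact ⟨⟨0, NeZero.pos n⟩, (wire_reach0W h u y).2 hi⟩
  | succ sv ih =>
    apply Bool.eq_iff_iff.2
    show Vl K x _ = true ↔ _
    rw [Vl_eq, decide_eq_true_iff]
    show (GateFn.or n).2 (fun i => GateDAG.wire x (Vl K x) (Kind.argsR L .reach (prm (vec2 u y) (it := it) (rd := ⟨sv + 1, hs⟩)) i)) = true ↔ _
    have ih' : ∀ a b : Fin n, ev x (aReach (r := r) L it ⟨sv, by omega⟩ a b) = decide (reachK x S sv a b) :=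
      fun a b => ih a b (by omega)
    simp only [GateFn.or, decide_eq_true_iff, Kind.argsR, prm_it, prm_vs, prm_rd, vec2_0, vec2_1, wire_w1]
    have hw : ∀ z : Fin n, Vl K x (.f1 (n1and [pos (aReach L it ⟨sv, by omega⟩ u z), pos (aReach L it ⟨sv, by omega⟩ z y)])) = true ↔
        reachK x S sv u z ∧ reachK x S sv z y := by
      intro z
      rw [Vl_n1and x _ (by simp)]
      simp [ih']
    simp only [hw]
    rfl

/-- **`conn it` computes `IsConn`.** -/
theorem ev_aConn (z : Fin n) : ev x (aConn (r := r) L it z) = decide (IsConn (G x) S.W S.c) := by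
  apply Bool.eq_iff_iff.2
  show Vl K x _ = true ↔ _
  rw [Vl_eq, decide_eq_true_iff]
  show (GateFn.and (n * n)).2 (fun i => GateDAG.wire x (Vl K x) (Kind.argsR L .conn (prm (vec1 z) (it := it)) i)) = true ↔ _
  simp only [GateFn.and, decide_eq_true_iff, Kind.argsR, prm_it, wire_w1]
  have hw : ∀ u y : Fin n, Vl K x (.f1 (n1or [neg (aW L it u), neg (aW L it y), pos (aReach L it (Fin.last n) u y)])) = true ↔
      (u ∉ S.W ∨ y ∉ S.W ∨ reachK x S n u y) := by
    intro u y
    rw [Vl_n1or x _ (by simp)]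
    simp [h.W, ev_aReach h]
  simp only [hw]
  constructor
  · intro hall u hu y hy
    rcases hall (finProdFinEquiv (u, y)) with h' | h' | h'
    · exact absurd hu (by simpa using h')
    · exact absurd hy (by simpa using h')
    · exact ((reachK_last_iff x).1 (by simpa using h')).2
  · intro hconn i
    by_cases hu : i.divNat ∈ S.W
    · by_cases hy : i.modNat ∈ S.W
      · exact Or.inr (Or.inr ((reachK_last_iff x).2 ⟨hu, hconn hu hy⟩))
      · exact Or.inr (Or.inl hy)
    · exact Or.inl hu

end WCan

end Summit.PneNP.PneNP.Theorems

end
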